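import Mathlib
import Literature.NumberTheory.LFunctions.LevinsonMontgomery
import HarnessLib

/-!
# The theta tail `∑_{r≥1} e^{-r²t}` and the asymptotics of `W(η) = ∑_r ∫_x^∞ e^{-r²u²η} u^{-θ} du`

Fourth support file for the proof of A. Selberg's positive-proportion theorem in the arrangement
of E. C. Titchmarsh, *The Theory of the Riemann Zeta-Function*, 2nd ed. (1986), §10.9–§10.22.
Everything here is PROVED; no named facts.

Titchmarsh §10.11 (p. 259) evaluates, for `η > 0`, `x ≥ 1`, `0 < θ ≤ ½`,
`W(η) := ∑_{r=1}^∞ ∫_x^∞ e^{-r²u²η} u^{-θ} du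
       = √π/(2θx^θ√η) + K₁(θ) η^{(θ-1)/2}/θ + O(x^{1-θ} log(2+η⁻¹)/θ)`
with `K₁(θ)` bounded, via the partial sums `∑_{r≤z} r^{θ-1}`. We prove the same expansion
(`abs_Wsum_sub_le`, with the slightly better error `O(x^{1-θ})`) by a different route: summing
first over `r` gives `W(η) = ∫_x^∞ u^{-θ} S(u²η) du` with the theta tail `S(t) = ∑_{r≥1} e^{-r²t}`
(`thetaTail`), the substitution `v = u√η` gives `W(η) = η^{(θ-1)/2} F(x√η)` with
`F(a) = ∫_a^∞ v^{-θ} S(v²) dv`, and the theta transformation formula (Mathlib's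
`HurwitzZeta.evenKernel_functional_equation`) gives `S(v²) = √π/(2v) - ½ + O(v⁻¹e^{-π²/v²})` on
`0 < v ≤ 1`, whence `F(a) = (√π/2θ) a^{-θ} + c(θ) + O(a^{1-θ})` with `|c(θ)| ≤ C/θ`.

## Main results

* `thetaTail`, `hasSum_thetaTail`, `thetaTail_eq_evenKernel`, `abs_thetaTail_sq_sub_le`
  (`|S(v²) - √π/(2v)| ≤ 4` on `(0,1]`), `thetaTail_le_two_mul_exp` (`S(t) ≤ 2e^{-t}` for `t ≥ 1`).
* `Wsum η x θ := ∑' r, ∫_{Ioi x} e^{-(r+1)²u²η} u^{-θ}`; `Wsum_eq_integral_thetaTail`;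
  `abs_Wsum_sub_le` — the expansion above.

## References

* [Titchmarsh1986] E. C. Titchmarsh, *The Theory of the Riemann Zeta-Function*, 2nd ed. revised by
  D. R. Heath-Brown, Oxford 1986, §10.11 (p. 259).
-/

noncomputable section

open Real MeasureTheory Set Filter HurwitzZeta
open scoped Topology

namespace Literature.NumberTheory.LFunctions.SelbergMollifier

/-! ## §1 The theta tail `S(t) = ∑_{r≥1} e^{-r²t}` -/

/-- `S(t) = ∑_{r ≥ 1} e^{-r² t}`. [cite: Titchmarsh1986, §10.11] -/
def thetaTail (t : ℝ) : ℝ := ∑' r : ℕ, Real.exp (-((r : ℝ) + 1) ^ 2 * t)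

/-- The terms of `S(t)` are dominated by the geometric series `e^{-(r+1)t}`. [folklore] -/
theorem exp_sq_le_geom {t : ℝ} (ht : 0 ≤ t) (r : ℕ) :
    Real.exp (-((r : ℝ) + 1) ^ 2 * t) ≤ Real.exp (-t) * Real.exp (-t) ^ r := by
  rw [← Real.exp_nat_mul, ← Real.exp_add]
  refine Real.exp_le_exp.mpr ?_
  have hr : (0 : ℝ) ≤ r := r.cast_nonneg
  nlinarith [mul_nonneg hr ht, mul_nonneg (mul_nonneg hr hr) ht]

/-- Summability of `S(t)` for `t > 0`. [folklore] -/
theorem summable_thetaTail {t : ℝ} (ht : 0 < t) :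
    Summable fun r : ℕ ↦ Real.exp (-((r : ℝ) + 1) ^ 2 * t) := by
  have hq1 : Real.exp (-t) < 1 := Real.exp_lt_one_iff.mpr (by linarith)
  refine Summable.of_nonneg_of_le (fun r ↦ (Real.exp_pos _).le) (exp_sq_le_geom ht.le)
    ((summable_geometric_of_lt_one (Real.exp_pos _).le hq1).mul_left _)

/-- `HasSum` form of the definition. [folklore] -/
theorem hasSum_thetaTail {t : ℝ} (ht : 0 < t) :
    HasSum (fun r : ℕ ↦ Real.exp (-((r : ℝ) + 1) ^ 2 * t)) (thetaTail t) :=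
  (summable_thetaTail ht).hasSum

/-- `S(t) ≥ 0`. [folklore] -/
theorem thetaTail_nonneg (t : ℝ) : 0 ≤ thetaTail t := tsum_nonneg fun _ ↦ (Real.exp_pos _).le

/-- **`S(t) ≤ e^{-t}/(1 - e^{-t})`** (`t > 0`). [folklore] -/
theorem thetaTail_le_geom {t : ℝ} (ht : 0 < t) : thetaTail t ≤ Real.exp (-t) / (1 - Real.exp (-t)) := by
  have hq1 : Real.exp (-t) < 1 := Real.exp_lt_one_iff.mpr (by linarith)
  have hgeom : HasSum (fun r : ℕ ↦ Real.exp (-t) * Real.exp (-t) ^ r) (Real.exp (-t) * (1 - Real.exp (-t))⁻¹) :=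
    (hasSum_geometric_of_lt_one (Real.exp_pos _).le hq1).mul_left _
  have := hasSum_le (exp_sq_le_geom ht.le) (hasSum_thetaTail ht) hgeom
  rwa [← div_eq_mul_inv] at this

/-- `S(t) ≤ 2e^{-t}` for `t ≥ 1`. [folklore] -/
theorem thetaTail_le_two_mul_exp {t : ℝ} (ht : 1 ≤ t) : thetaTail t ≤ 2 * Real.exp (-t) := by
  refine (thetaTail_le_geom (by linarith)).trans ?_
  have h1 : Real.exp (-t) ≤ 1 / 2 := by
    have := Real.exp_le_exp.mpr (show -t ≤ -1 by linarith)
    have h2 : Real.exp (-1) ≤ 1 / 2 := by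
      rw [Real.exp_neg, inv_le_comm₀ (Real.exp_pos _) (by norm_num)]
      have := Real.add_one_le_exp (1 : ℝ); linarith
    linarith
  rw [div_le_iff₀ (by linarith)]
  nlinarith [Real.exp_pos (-t)]

/-- **`S(t) = (ϑ(t/π) - 1)/2`** with Mathlib's theta function `ϑ = evenKernel 0`
(`ϑ(x) = ∑_{n∈ℤ} e^{-πn²x}`). [folklore] -/
theorem thetaTail_eq_evenKernel {t : ℝ} (ht : 0 < t) :
    thetaTail t = (evenKernel 0 (t / π) - 1) / 2 := by
  have h := hasSum_nat_cosKernel₀ 0 (div_pos ht Real.pi_pos)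
  simp only [mul_zero, zero_mul, Real.cos_zero, mul_one, QuotientAddGroup.mk_zero] at h
  rw [← evenKernel_eq_cosKernel_of_zero] at h
  have h2 : HasSum (fun n : ℕ ↦ 2 * Real.exp (-((n : ℝ) + 1) ^ 2 * t)) (evenKernel 0 (t / π) - 1) := by
    refine h.congr_fun fun n ↦ ?_
    congr 1
    field_simp
  have h3 := (hasSum_thetaTail ht).mul_left 2
  have := h2.unique h3
  linarith

/-- `ϑ(u) - 1 ≤ 4 e^{-πu}` for `u ≥ 1`. [folklore] -/
theorem evenKernel_zero_sub_one_le' {u : ℝ} (hu : 1 ≤ u) : evenKernel 0 u - 1 ≤ 4 * Real.exp (-π * u) := by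
  have h := thetaTail_eq_evenKernel (t := u * π) (by positivity)
  rw [mul_div_cancel_right₀ _ Real.pi_pos.ne'] at h
  have hb := thetaTail_le_two_mul_exp (t := u * π) (by nlinarith [Real.pi_gt_three])
  rw [show -(u * π) = -π * u by ring] at hb
  linarith

/-- **The theta transformation on `(0,1]`**: `|S(v²) - √π/(2v)| ≤ 4` for `0 < v ≤ 1` (indeed
`S(v²) = √π/(2v) - ½ + O(v⁻¹ e^{-π²/v²})`). [folklore] -/
theorem abs_thetaTail_sq_sub_le {v : ℝ} (hv : 0 < v) (hv1 : v ≤ 1) :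
    |thetaTail (v ^ 2) - Real.sqrt π / (2 * v)| ≤ 4 := by
  have hπ := Real.pi_pos
  have hv2 : 0 < v ^ 2 := by positivity
  rw [thetaTail_eq_evenKernel hv2]
  -- `ϑ(v²/π) = (√π/v) ϑ(π/v²)`
  have hfe : evenKernel 0 (v ^ 2 / π) = Real.sqrt π / v * evenKernel 0 (π / v ^ 2) := by
    rw [evenKernel_functional_equation 0 (v ^ 2 / π), ← evenKernel_eq_cosKernel_of_zero, one_div_div]
    congr 1
    rw [← Real.sqrt_eq_rpow, Real.sqrt_div' _ hπ.le, Real.sqrt_sq hv.le]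
    field_simp
  rw [hfe]
  set T := evenKernel 0 (π / v ^ 2) - 1 with hT
  have hu : 1 ≤ π / v ^ 2 := by
    rw [le_div_iff₀ hv2]; nlinarith [Real.pi_gt_three]
  have hT0 : 0 ≤ T := by have := RealZeros.one_le_evenKernel_zero (t := π / v ^ 2) (by positivity); linarith
  have hT1 : T ≤ 4 * Real.exp (-π * (π / v ^ 2)) := evenKernel_zero_sub_one_le' hu
  -- `e^{-π²/v²} ≤ v`
  have hexp : Real.exp (-π * (π / v ^ 2)) ≤ v := by
    have h1 : v⁻¹ ≤ π * (π / v ^ 2) := by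
      rw [show π * (π / v ^ 2) = π ^ 2 * (v⁻¹ * v⁻¹) by field_simp]
      have hvi : 1 ≤ v⁻¹ := (one_le_inv₀ hv).mpr hv1
      have hA : v⁻¹ ≤ v⁻¹ * v⁻¹ := le_mul_of_one_le_right (by positivity) hvi
      have hB : v⁻¹ * v⁻¹ ≤ π ^ 2 * (v⁻¹ * v⁻¹) :=
        le_mul_of_one_le_left (by positivity) (by nlinarith [Real.pi_gt_three])
      exact hA.trans hB
    have h2 : π * (π / v ^ 2) ≤ Real.exp (π * (π / v ^ 2)) := by
      have := Real.add_one_le_exp (π * (π / v ^ 2)); linarith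
    rw [show -π * (π / v ^ 2) = -(π * (π / v ^ 2)) by ring, Real.exp_neg, inv_le_comm₀ (Real.exp_pos _) hv]
    linarith
  have hkey : (Real.sqrt π / v * (T + 1) - 1) / 2 - Real.sqrt π / (2 * v) = Real.sqrt π / (2 * v) * T - 1 / 2 := by
    field_simp; ring
  rw [show evenKernel 0 (π / v ^ 2) = T + 1 by rw [hT]; ring, hkey]
  have hsπ : Real.sqrt π ≤ 2 := by
    rw [Real.sqrt_le_left (by norm_num)]; linarith [Real.pi_lt_four]
  have hbd : Real.sqrt π / (2 * v) * T ≤ 4 := by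
    calc Real.sqrt π / (2 * v) * T ≤ Real.sqrt π / (2 * v) * (4 * v) := by
          refine mul_le_mul_of_nonneg_left (hT1.trans (by linarith)) (by positivity)
      _ = 2 * Real.sqrt π := by field_simp; ring
      _ ≤ 4 := by linarith
  have hnn : 0 ≤ Real.sqrt π / (2 * v) * T := by positivity
  rw [abs_le]; constructor <;> linarith

/-- `S` is continuous on `(0, ∞)`. [folklore] -/
theorem continuousOn_thetaTail : ContinuousOn thetaTail (Ioi 0) := by
  have h : ContinuousOn (fun t : ℝ ↦ (evenKernel 0 (t / π) - 1) / 2) (Ioi 0) := by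
    refine ContinuousOn.div_const (ContinuousOn.sub ?_ continuousOn_const) _
    refine (continuousOn_evenKernel 0).comp (continuousOn_id.div_const _) fun t ht ↦ ?_
    exact div_pos ht Real.pi_pos
  exact h.congr fun t ht ↦ thetaTail_eq_evenKernel ht

/-! ## §2 `W(η) = ∑_r ∫_x^∞ e^{-r²u²η} u^{-θ} du` as a single integral -/

/-- **Titchmarsh's `r`-sum** `W(η; x, θ) = ∑_{r≥1} ∫_x^∞ e^{-r²u²η} u^{-θ} du` (§10.11, p. 259).
[cite: Titchmarsh1986, §10.11] -/
def Wsum (η x θ : ℝ) : ℝ :=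
  ∑' r : ℕ, ∫ u in Ioi x, Real.exp (-((r : ℝ) + 1) ^ 2 * u ^ 2 * η) * u ^ (-θ)

/-- The `r`-th integrand is continuous on `(0,∞)`. [folklore] -/
theorem continuousOn_Wintegrand (η θ : ℝ) (r : ℕ) :
    ContinuousOn (fun u : ℝ ↦ Real.exp (-((r : ℝ) + 1) ^ 2 * u ^ 2 * η) * u ^ (-θ)) (Ioi 0) := by
  refine ContinuousOn.mul (by fun_prop) ?_
  exact continuousOn_id.rpow_const fun u hu ↦ Or.inl (ne_of_gt hu)

/-- Bound for the `r`-th integrand on `(x, ∞)`, `x ≥ 1`: by the decaying exponential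
`e^{-(r+1)²xη·u}`. [folklore] -/
theorem Wintegrand_le {η x θ : ℝ} (hη : 0 < η) (hx : 1 ≤ x) (hθ : 0 ≤ θ) (r : ℕ) {u : ℝ} (hu : x < u) :
    Real.exp (-((r : ℝ) + 1) ^ 2 * u ^ 2 * η) * u ^ (-θ) ≤
      Real.exp (-(((r : ℝ) + 1) ^ 2 * x * η) * u) := by
  have hu1 : 1 ≤ u := by linarith
  have h1 : u ^ (-θ) ≤ 1 := Real.rpow_le_one_of_one_le_of_nonpos hu1 (by linarith)
  have h2 : Real.exp (-((r : ℝ) + 1) ^ 2 * u ^ 2 * η) ≤ Real.exp (-(((r : ℝ) + 1) ^ 2 * x * η) * u) := by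
    refine Real.exp_le_exp.mpr ?_
    have : x * u ≤ u ^ 2 := by nlinarith
    nlinarith [mul_nonneg (sq_nonneg ((r : ℝ) + 1)) hη.le]
  calc _ ≤ Real.exp (-((r : ℝ) + 1) ^ 2 * u ^ 2 * η) * 1 :=
        mul_le_mul_of_nonneg_left h1 (Real.exp_pos _).le
    _ ≤ _ := by rw [mul_one]; exact h2

/-- Integrability of the `r`-th integrand on `(x, ∞)`, `x ≥ 1`. [folklore] -/
theorem integrableOn_Wintegrand {η x θ : ℝ} (hη : 0 < η) (hx : 1 ≤ x) (hθ : 0 ≤ θ) (r : ℕ) :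
    IntegrableOn (fun u : ℝ ↦ Real.exp (-((r : ℝ) + 1) ^ 2 * u ^ 2 * η) * u ^ (-θ)) (Ioi x) := by
  have hx0 : 0 < x := by linarith
  have hc : 0 < ((r : ℝ) + 1) ^ 2 * x * η := by positivity
  have hsub : Ioi x ⊆ Ioi 0 := Ioi_subset_Ioi hx0.le
  refine Integrable.mono' (integrableOn_exp_mul_Ioi (a := -(((r : ℝ) + 1) ^ 2 * x * η)) (by linarith) x)
    (((continuousOn_Wintegrand η θ r).mono hsub).aestronglyMeasurable measurableSet_Ioi) ?_
  refine (ae_restrict_iff' measurableSet_Ioi).mpr (Eventually.of_forall fun u hu ↦ ?_)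
  have hu0 : 0 ≤ u := by linarith [mem_Ioi.mp hu]
  rw [Real.norm_eq_abs, abs_of_nonneg (mul_nonneg (Real.exp_pos _).le (Real.rpow_nonneg hu0 _))]
  exact Wintegrand_le hη hx hθ r hu

/-- The `r`-th integral is at most `(xη)⁻¹ q^{r+1}` with `q = e^{-x²η} < 1`. [folklore] -/
theorem integral_Wintegrand_le {η x θ : ℝ} (hη : 0 < η) (hx : 1 ≤ x) (hθ : 0 ≤ θ) (r : ℕ) :
    ∫ u in Ioi x, Real.exp (-((r : ℝ) + 1) ^ 2 * u ^ 2 * η) * u ^ (-θ) ≤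
      (x * η)⁻¹ * Real.exp (-(x ^ 2 * η)) ^ (r + 1) := by
  have hx0 : 0 < x := by linarith
  have hc : 0 < ((r : ℝ) + 1) ^ 2 * x * η := by positivity
  calc ∫ u in Ioi x, Real.exp (-((r : ℝ) + 1) ^ 2 * u ^ 2 * η) * u ^ (-θ)
      ≤ ∫ u in Ioi x, Real.exp (-(((r : ℝ) + 1) ^ 2 * x * η) * u) := by
        refine setIntegral_mono_on (integrableOn_Wintegrand hη hx hθ r)
          (integrableOn_exp_mul_Ioi (by linarith) x) measurableSet_Ioi fun u hu ↦ Wintegrand_le hη hx hθ r hu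
    _ = Real.exp (-(((r : ℝ) + 1) ^ 2 * x * η) * x) / (((r : ℝ) + 1) ^ 2 * x * η) := by
        rw [integral_exp_mul_Ioi (by linarith)]; field_simp
    _ ≤ Real.exp (-(x ^ 2 * η)) ^ (r + 1) / (1 * x * η) := by
        gcongr
        · rw [← Real.exp_nat_mul]
          refine Real.exp_le_exp.mpr ?_
          push_cast
          have h1 : (r : ℝ) + 1 ≤ ((r : ℝ) + 1) ^ 2 := by nlinarith [r.cast_nonneg (α := ℝ)]
          nlinarith [mul_nonneg (mul_nonneg (by linarith : (0:ℝ) ≤ x) (by linarith : (0:ℝ) ≤ x)) hη.le]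
        · nlinarith [r.cast_nonneg (α := ℝ)]
    _ = (x * η)⁻¹ * Real.exp (-(x ^ 2 * η)) ^ (r + 1) := by rw [one_mul, div_eq_inv_mul]

/-- **`W(η) = ∫_x^∞ u^{-θ} S(u²η) du`** (interchange of the `r`-sum and the integral; everything is
nonnegative). [cite: Titchmarsh1986, §10.11] -/
theorem Wsum_eq_integral_thetaTail {η x θ : ℝ} (hη : 0 < η) (hx : 1 ≤ x) (hθ : 0 ≤ θ) :
    Wsum η x θ = ∫ u in Ioi x, u ^ (-θ) * thetaTail (u ^ 2 * η) := by
  have hx0 : 0 < x := by linarith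
  rw [Wsum, integral_tsum_of_summable_integral_norm (fun r ↦ integrableOn_Wintegrand hη hx hθ r)]
  · refine integral_congr_ae ((ae_restrict_iff' measurableSet_Ioi).mpr (Eventually.of_forall fun u _ ↦ ?_))
    simp only [thetaTail]
    rw [← tsum_mul_left]
    refine tsum_congr fun r ↦ ?_
    ring_nf
  · have hq0 : 0 ≤ Real.exp (-(x ^ 2 * η)) := (Real.exp_pos _).le
    have hq1 : Real.exp (-(x ^ 2 * η)) < 1 := Real.exp_lt_one_iff.mpr (neg_neg_of_pos (by positivity))
    refine Summable.of_nonneg_of_le (fun r ↦ integral_nonneg fun u ↦ norm_nonneg _) (fun r ↦ ?_)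
      (((summable_geometric_of_lt_one hq0 hq1).mul_left (Real.exp (-(x ^ 2 * η)))).mul_left (x * η)⁻¹)
    calc ∫ u in Ioi x, ‖Real.exp (-((r : ℝ) + 1) ^ 2 * u ^ 2 * η) * u ^ (-θ)‖
        = ∫ u in Ioi x, Real.exp (-((r : ℝ) + 1) ^ 2 * u ^ 2 * η) * u ^ (-θ) := by
          refine setIntegral_congr_fun measurableSet_Ioi fun u hu ↦ ?_
          have hu0 : 0 ≤ u := by linarith [mem_Ioi.mp hu]
          rw [Real.norm_eq_abs, abs_of_nonneg (mul_nonneg (Real.exp_pos _).le (Real.rpow_nonneg hu0 _))]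
      _ ≤ (x * η)⁻¹ * Real.exp (-(x ^ 2 * η)) ^ (r + 1) := integral_Wintegrand_le hη hx hθ r
      _ = (x * η)⁻¹ * (Real.exp (-(x ^ 2 * η)) * Real.exp (-(x ^ 2 * η)) ^ r) := by rw [pow_succ']

/-- **The substitution `v = u√η`**: `∫_x^∞ u^{-θ} S(u²η) du = η^{(θ-1)/2} ∫_{x√η}^∞ v^{-θ} S(v²) dv`.
[cite: Titchmarsh1986, §10.11] -/
theorem integral_thetaTail_subst {η x θ : ℝ} (hη : 0 < η) (hx : 0 ≤ x) :
    ∫ u in Ioi x, u ^ (-θ) * thetaTail (u ^ 2 * η) =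
      η ^ ((θ - 1) / 2) * ∫ v in Ioi (Real.sqrt η * x), v ^ (-θ) * thetaTail (v ^ 2) := by
  have hs : 0 < Real.sqrt η := Real.sqrt_pos.mpr hη
  set g : ℝ → ℝ := fun v ↦ η ^ (θ / 2) * (v ^ (-θ) * thetaTail (v ^ 2)) with hg
  have hpt : ∀ u ∈ Ioi x, u ^ (-θ) * thetaTail (u ^ 2 * η) = g (Real.sqrt η * u) := by
    intro u hu
    have hu : 0 ≤ u := hx.trans (le_of_lt hu)
    simp only [hg]
    rw [mul_pow, Real.sq_sqrt hη.le, Real.mul_rpow hs.le hu, mul_comm (u ^ 2) η]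
    have : η ^ (θ / 2) * (Real.sqrt η) ^ (-θ) = 1 := by
      rw [Real.sqrt_eq_rpow η, ← Real.rpow_mul hη.le, ← Real.rpow_add hη]; ring_nf; exact Real.rpow_zero η
    calc u ^ (-θ) * thetaTail (η * u ^ 2) = (η ^ (θ / 2) * (Real.sqrt η) ^ (-θ)) * (u ^ (-θ) * thetaTail (η * u ^ 2)) := by
          rw [this, one_mul]
      _ = _ := by ring
  rw [setIntegral_congr_fun measurableSet_Ioi hpt]
  have hcomp := integral_comp_mul_left_Ioi g x hs
  rw [hcomp, smul_eq_mul]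
  simp only [hg]
  rw [integral_const_mul, ← mul_assoc]
  congr 1
  rw [Real.sqrt_eq_rpow η, ← Real.rpow_neg_one, ← Real.rpow_mul hη.le, ← Real.rpow_add hη]
  ring_nf

/-! ## §3 `F(a) = ∫_a^∞ v^{-θ} S(v²) dv = (√π/2θ) a^{-θ} + c(θ) + O(a^{1-θ})` -/

/-- The regular part on `(0,1]`: `k_θ(v) = v^{-θ}(S(v²) - √π/(2v))`. [folklore] -/
def kfunW (θ v : ℝ) : ℝ := v ^ (-θ) * (thetaTail (v ^ 2) - Real.sqrt π / (2 * v))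

/-- `|k_θ(v)| ≤ 4 v^{-θ}` on `(0, 1]`. [folklore] -/
theorem abs_kfunW_le {θ v : ℝ} (hv : 0 < v) (hv1 : v ≤ 1) : |kfunW θ v| ≤ 4 * v ^ (-θ) := by
  rw [kfunW, abs_mul, abs_of_pos (Real.rpow_pos_of_pos hv _), mul_comm]
  exact mul_le_mul_of_nonneg_right (abs_thetaTail_sq_sub_le hv hv1) (by positivity)

/-- `v ↦ v^{-θ} S(v²)` is continuous on `(0,∞)`. [folklore] -/
theorem continuousOn_rpow_mul_thetaTail (θ : ℝ) :
    ContinuousOn (fun v : ℝ ↦ v ^ (-θ) * thetaTail (v ^ 2)) (Ioi 0) := by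
  refine ContinuousOn.mul (continuousOn_id.rpow_const fun u hu ↦ Or.inl (ne_of_gt hu)) ?_
  exact continuousOn_thetaTail.comp (by fun_prop) fun v hv ↦ by simp only [mem_Ioi] at hv ⊢; positivity

/-- `k_θ` is continuous on `(0, ∞)`. [folklore] -/
theorem continuousOn_kfunW (θ : ℝ) : ContinuousOn (kfunW θ) (Ioi 0) := by
  unfold kfunW
  refine ContinuousOn.mul (continuousOn_id.rpow_const fun u hu ↦ Or.inl (ne_of_gt hu)) ?_
  refine ContinuousOn.sub ?_ ?_
  · exact continuousOn_thetaTail.comp (by fun_prop) fun v hv ↦ by simp only [mem_Ioi] at hv ⊢; positivity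
  · exact ContinuousOn.div continuousOn_const (by fun_prop) fun v hv ↦ by simp only [mem_Ioi] at hv; positivity

/-- `k_θ` is integrable on `(0, b]` for `θ < 1`, `b ≤ 1`. [folklore] -/
theorem integrableOn_kfunW {θ b : ℝ} (hθ : θ < 1) (hb : b ≤ 1) : IntegrableOn (kfunW θ) (Ioc 0 b) := by
  rcases le_or_gt b 0 with hb0 | hb0
  · rw [Ioc_eq_empty (by simp [hb0])]; exact integrableOn_empty
  have hrpow : IntegrableOn (fun v : ℝ ↦ 4 * v ^ (-θ)) (Ioc 0 b) := by
    have := (intervalIntegral.intervalIntegrable_rpow' (a := 0) (b := b) (r := -θ) (by linarith)).1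
    rw [IntegrableOn]
    exact this.const_mul 4
  refine hrpow.mono' ((continuousOn_kfunW θ).mono Ioc_subset_Ioi_self |>.aestronglyMeasurable measurableSet_Ioc) ?_
  refine (ae_restrict_iff' measurableSet_Ioc).mpr (Eventually.of_forall fun v hv ↦ ?_)
  rw [Real.norm_eq_abs]
  exact abs_kfunW_le hv.1 (hv.2.trans hb)

/-- `|∫_{(0,b]} k_θ| ≤ 8 b^{1-θ}` for `0 ≤ b ≤ 1`, `θ ≤ ½`. [folklore] -/
theorem abs_integral_kfunW_le {θ b : ℝ} (hθ : θ ≤ 1 / 2) (hb0 : 0 ≤ b) (hb : b ≤ 1) :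
    |∫ v in Ioc 0 b, kfunW θ v| ≤ 8 * b ^ (1 - θ) := by
  have hθ1 : θ < 1 := by linarith
  calc |∫ v in Ioc 0 b, kfunW θ v| ≤ ∫ v in Ioc 0 b, |kfunW θ v| := abs_integral_le_integral_abs
    _ ≤ ∫ v in Ioc 0 b, 4 * v ^ (-θ) := by
        refine setIntegral_mono_on (integrableOn_kfunW hθ1 hb).abs ?_ measurableSet_Ioc fun v hv ↦
          abs_kfunW_le hv.1 (hv.2.trans hb)
        have := (intervalIntegral.intervalIntegrable_rpow' (a := 0) (b := b) (r := -θ) (by linarith)).1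
        exact this.const_mul 4
    _ = 4 * (b ^ (1 - θ) / (1 - θ)) := by
        rw [← intervalIntegral.integral_of_le hb0, intervalIntegral.integral_const_mul,
          integral_rpow (Or.inl (by linarith))]
        simp [Real.zero_rpow (by linarith : (-θ + 1) ≠ 0)]
        ring_nf
    _ ≤ 8 * b ^ (1 - θ) := by
        rw [mul_div_assoc']
        rw [div_le_iff₀ (by linarith)]
        nlinarith [Real.rpow_nonneg hb0 (1 - θ)]

/-- `v^{-θ} S(v²)` is integrable on `(1, ∞)` (bounded by `2e^{-v}`), for `θ ≥ 0`. [folklore] -/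
theorem integrableOn_rpow_mul_thetaTail_Ioi {θ : ℝ} (hθ : 0 ≤ θ) :
    IntegrableOn (fun v : ℝ ↦ v ^ (-θ) * thetaTail (v ^ 2)) (Ioi 1) := by
  refine Integrable.mono' ((integrableOn_exp_mul_Ioi (a := -1) (by norm_num) 1).const_mul 2)
    ((continuousOn_rpow_mul_thetaTail θ).mono (Ioi_subset_Ioi zero_le_one)
      |>.aestronglyMeasurable measurableSet_Ioi) ?_
  refine (ae_restrict_iff' measurableSet_Ioi).mpr (Eventually.of_forall fun v (hv : 1 < v) ↦ ?_)
  rw [Real.norm_eq_abs, abs_of_nonneg (mul_nonneg (Real.rpow_nonneg (by linarith) _) (thetaTail_nonneg _))]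
  have h1 : v ^ (-θ) ≤ 1 := Real.rpow_le_one_of_one_le_of_nonpos hv.le (by linarith)
  have h2 : thetaTail (v ^ 2) ≤ 2 * Real.exp (-(v ^ 2)) := thetaTail_le_two_mul_exp (by nlinarith)
  have h3 : Real.exp (-(v ^ 2)) ≤ Real.exp (-1 * v) := Real.exp_le_exp.mpr (by nlinarith)
  calc v ^ (-θ) * thetaTail (v ^ 2) ≤ 1 * (2 * Real.exp (-(v ^ 2))) :=
        mul_le_mul h1 h2 (thetaTail_nonneg _) zero_le_one
    _ ≤ 2 * Real.exp (-1 * v) := by linarith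

/-- `0 ≤ ∫_{(1,∞)∩(b,∞)…}`: the tail integral over `(b, ∞)`, `b ≥ 1`, is between `0` and `2`. [folklore] -/
theorem integral_rpow_mul_thetaTail_Ioi_le {θ b : ℝ} (hθ : 0 ≤ θ) (hb : 1 ≤ b) :
    0 ≤ ∫ v in Ioi b, v ^ (-θ) * thetaTail (v ^ 2) ∧ ∫ v in Ioi b, v ^ (-θ) * thetaTail (v ^ 2) ≤ 2 := by
  have hint := (integrableOn_rpow_mul_thetaTail_Ioi hθ).mono_set (Ioi_subset_Ioi hb)
  constructor
  · exact setIntegral_nonneg measurableSet_Ioi fun v hv ↦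
      mul_nonneg (Real.rpow_nonneg (by linarith [mem_Ioi.mp hv]) _) (thetaTail_nonneg _)
  · calc ∫ v in Ioi b, v ^ (-θ) * thetaTail (v ^ 2) ≤ ∫ v in Ioi b, 2 * Real.exp (-1 * v) := by
          refine setIntegral_mono_on hint ((integrableOn_exp_mul_Ioi (by norm_num) b).const_mul 2)
            measurableSet_Ioi fun v hv ↦ ?_
          have hv1 : 1 < v := lt_of_le_of_lt hb hv
          have h1 : v ^ (-θ) ≤ 1 := Real.rpow_le_one_of_one_le_of_nonpos hv1.le (by linarith)
          have h2 : thetaTail (v ^ 2) ≤ 2 * Real.exp (-(v ^ 2)) := thetaTail_le_two_mul_exp (by nlinarith)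
          have h3 : Real.exp (-(v ^ 2)) ≤ Real.exp (-1 * v) := Real.exp_le_exp.mpr (by nlinarith)
          calc v ^ (-θ) * thetaTail (v ^ 2) ≤ 1 * (2 * Real.exp (-(v ^ 2))) :=
                mul_le_mul h1 h2 (thetaTail_nonneg _) zero_le_one
            _ ≤ 2 * Real.exp (-1 * v) := by linarith
      _ = 2 * Real.exp (-b) := by
          rw [integral_const_mul, integral_exp_mul_Ioi (by norm_num)]; ring_nf
      _ ≤ 2 := by
          have : Real.exp (-b) ≤ 1 := Real.exp_le_one_iff.mpr (by linarith)
          linarith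

/-- **The constant `c(θ)`** (Titchmarsh's `K₁(θ)/θ`):
`c(θ) = ∫_0^1 k_θ + ∫_1^∞ v^{-θ}S(v²) - √π/(2θ)`. [cite: Titchmarsh1986, §10.11] -/
def cW (θ : ℝ) : ℝ :=
  (∫ v in Ioc 0 1, kfunW θ v) + (∫ v in Ioi 1, v ^ (-θ) * thetaTail (v ^ 2)) - Real.sqrt π / (2 * θ)

/-- `|c(θ)| ≤ 11/θ` for `0 < θ ≤ ½`. [cite: Titchmarsh1986, §10.11] -/
theorem abs_cW_le {θ : ℝ} (hθ : 0 < θ) (hθ1 : θ ≤ 1 / 2) : |cW θ| ≤ 11 / θ := by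
  have h1 := abs_integral_kfunW_le hθ1 zero_le_one le_rfl
  rw [Real.one_rpow, mul_one] at h1
  obtain ⟨h2, h3⟩ := integral_rpow_mul_thetaTail_Ioi_le hθ.le le_rfl
  have h4 : Real.sqrt π / (2 * θ) ≤ 1 / θ := by
    have hsπ : Real.sqrt π ≤ 2 := by
      rw [Real.sqrt_le_left (by norm_num)]; linarith [Real.pi_lt_four]
    rw [div_le_div_iff₀ (by positivity) hθ]; nlinarith
  have h5 : 0 ≤ Real.sqrt π / (2 * θ) := by positivity
  have h10 : (10 : ℝ) ≤ 10 / θ := by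
    rw [le_div_iff₀ hθ]; nlinarith
  rw [cW, abs_le]
  rw [abs_le] at h1
  constructor
  · have : -(11 / θ) = -(1 / θ) - 10 / θ := by ring
    linarith
  · have : 11 / θ = 1 / θ + 10 / θ := by ring
    linarith

/-- `F(a) = ∫_a^∞ v^{-θ} S(v²) dv` exists: integrability on `(a, ∞)`, `a > 0`. [folklore] -/
theorem integrableOn_rpow_mul_thetaTail {θ a : ℝ} (hθ : 0 ≤ θ) (hθ1 : θ < 1) (ha : 0 < a) :
    IntegrableOn (fun v : ℝ ↦ v ^ (-θ) * thetaTail (v ^ 2)) (Ioi a) := by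
  -- on `(a, 1]` the function is `k_θ + (√π/2) v^{-1-θ}`, both integrable; on `(1,∞)` use the above
  rcases le_or_gt 1 a with ha1 | ha1
  · exact (integrableOn_rpow_mul_thetaTail_Ioi hθ).mono_set (Ioi_subset_Ioi ha1)
  have hsplit : Ioi a = Ioc a 1 ∪ Ioi 1 := (Ioc_union_Ioi_eq_Ioi ha1.le).symm
  rw [hsplit]
  refine IntegrableOn.union ?_ (integrableOn_rpow_mul_thetaTail_Ioi hθ)
  have hk : IntegrableOn (kfunW θ) (Ioc a 1) := (integrableOn_kfunW hθ1 le_rfl).mono_set (Ioc_subset_Ioc ha.le le_rfl)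
  have hp : IntegrableOn (fun v : ℝ ↦ Real.sqrt π / 2 * v ^ (-1 - θ)) (Ioc a 1) := by
    have hc : ContinuousOn (fun v : ℝ ↦ Real.sqrt π / 2 * v ^ (-1 - θ)) (Icc a 1) :=
      ContinuousOn.mul continuousOn_const (continuousOn_id.rpow_const fun v hv ↦ Or.inl (by linarith [hv.1] : v ≠ 0))
    exact (hc.integrableOn_compact isCompact_Icc).mono_set Ioc_subset_Icc_self
  refine (hk.add hp).congr_fun (fun v hv ↦ ?_) measurableSet_Ioc
  have hv0 : 0 < v := ha.trans hv.1
  simp only [kfunW, Pi.add_apply]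
  rw [show (-1 - θ : ℝ) = -θ + (-1) by ring, Real.rpow_add hv0, Real.rpow_neg_one]
  field_simp
  ring

/-- **The expansion of `F(a) = ∫_a^∞ v^{-θ}S(v²)dv`**: `|F(a) - (√π/2θ)a^{-θ} - c(θ)| ≤ 12 a^{1-θ}` for
`a > 0`, `0 < θ ≤ ½`. [cite: Titchmarsh1986, §10.11] -/
theorem abs_F_sub_le {θ a : ℝ} (hθ : 0 < θ) (hθ1 : θ ≤ 1 / 2) (ha : 0 < a) :
    |(∫ v in Ioi a, v ^ (-θ) * thetaTail (v ^ 2)) - Real.sqrt π / (2 * θ) * a ^ (-θ) - cW θ| ≤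
      12 * a ^ (1 - θ) := by
  have hθ' : θ < 1 := by linarith
  rcases le_or_gt a 1 with ha1 | ha1
  · -- `a ≤ 1`: `F(a) = ∫_{(a,1]} k + (√π/2θ)(a^{-θ} - 1) + ∫_{(1,∞)}`
    have hsplit : Ioi a = Ioc a 1 ∪ Ioi 1 := (Ioc_union_Ioi_eq_Ioi ha1).symm
    have hdisj : Disjoint (Ioc a 1) (Ioi 1) := fun s h1 h2 x hx ↦ by
      have := (h1 hx).2; have := h2 hx; simp only [mem_Ioi] at this; linarith
    have hI1 : IntegrableOn (fun v : ℝ ↦ v ^ (-θ) * thetaTail (v ^ 2)) (Ioc a 1) :=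
      (integrableOn_rpow_mul_thetaTail hθ.le hθ' ha).mono_set (by rw [hsplit]; exact subset_union_left)
    rw [hsplit, setIntegral_union hdisj measurableSet_Ioi hI1 (integrableOn_rpow_mul_thetaTail_Ioi hθ.le)]
    -- the piece over `(a,1]`
    have hk : IntegrableOn (kfunW θ) (Ioc a 1) := (integrableOn_kfunW hθ' le_rfl).mono_set (Ioc_subset_Ioc ha.le le_rfl)
    have hpow_int : ∫ v in Ioc a 1, Real.sqrt π / 2 * v ^ (-1 - θ) = Real.sqrt π / (2 * θ) * (a ^ (-θ) - 1) := by
      rw [← intervalIntegral.integral_of_le ha1, intervalIntegral.integral_const_mul,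
        integral_rpow (Or.inr ⟨by linarith, by
          rw [Set.uIcc_of_le ha1]; exact fun h ↦ by have := h.1; linarith⟩)]
      rw [show (-1 - θ + 1 : ℝ) = -θ by ring, Real.one_rpow]
      field_simp
      ring
    have hp : IntegrableOn (fun v : ℝ ↦ Real.sqrt π / 2 * v ^ (-1 - θ)) (Ioc a 1) := by
      have hc : ContinuousOn (fun v : ℝ ↦ Real.sqrt π / 2 * v ^ (-1 - θ)) (Icc a 1) :=
        ContinuousOn.mul continuousOn_const (continuousOn_id.rpow_const fun v hv ↦ Or.inl (by linarith [hv.1] : v ≠ 0))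
      exact (hc.integrableOn_compact isCompact_Icc).mono_set Ioc_subset_Icc_self
    have hpiece : ∫ v in Ioc a 1, v ^ (-θ) * thetaTail (v ^ 2) =
        (∫ v in Ioc a 1, kfunW θ v) + Real.sqrt π / (2 * θ) * (a ^ (-θ) - 1) := by
      rw [← hpow_int, ← integral_add hk hp]
      refine setIntegral_congr_fun measurableSet_Ioc fun v hv ↦ ?_
      have hv0 : 0 < v := ha.trans hv.1
      simp only [kfunW]
      rw [show (-1 - θ : ℝ) = -θ + (-1) by ring, Real.rpow_add hv0, Real.rpow_neg_one]
      field_simp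
      ring
    -- `∫_{(a,1]} k = ∫_{(0,1]} k - ∫_{(0,a]} k`
    have hk01 : ∫ v in Ioc 0 1, kfunW θ v = (∫ v in Ioc 0 a, kfunW θ v) + ∫ v in Ioc a 1, kfunW θ v := by
      rw [← Ioc_union_Ioc_eq_Ioc ha.le ha1, setIntegral_union (Ioc_disjoint_Ioc_of_le le_rfl) measurableSet_Ioc
        ((integrableOn_kfunW hθ' le_rfl).mono_set (Ioc_subset_Ioc le_rfl ha1)) hk]
    have hka := abs_integral_kfunW_le hθ1 ha.le ha1
    rw [hpiece, cW]
    have : (∫ v in Ioc a 1, kfunW θ v) + Real.sqrt π / (2 * θ) * (a ^ (-θ) - 1) +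
          (∫ v in Ioi 1, v ^ (-θ) * thetaTail (v ^ 2)) - Real.sqrt π / (2 * θ) * a ^ (-θ) -
          ((∫ v in Ioc 0 1, kfunW θ v) + (∫ v in Ioi 1, v ^ (-θ) * thetaTail (v ^ 2)) - Real.sqrt π / (2 * θ)) =
        -(∫ v in Ioc 0 a, kfunW θ v) := by rw [hk01]; ring
    rw [this, abs_neg]
    linarith [Real.rpow_nonneg ha.le (1 - θ)]
  · -- `a > 1`: `F(a) = ∫_{(1,∞)} - ∫_{(1,a]}`
    have hsplit : Ioi (1 : ℝ) = Ioc 1 a ∪ Ioi a := (Ioc_union_Ioi_eq_Ioi ha1.le).symm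
    have hdisj : Disjoint (Ioc 1 a) (Ioi a) := fun s h1 h2 x hx ↦ by
      have := (h1 hx).2; have := h2 hx; simp only [mem_Ioi] at this; linarith
    have hI : IntegrableOn (fun v : ℝ ↦ v ^ (-θ) * thetaTail (v ^ 2)) (Ioi 1) := integrableOn_rpow_mul_thetaTail_Ioi hθ.le
    have h1a : ∫ v in Ioi 1, v ^ (-θ) * thetaTail (v ^ 2) =
        (∫ v in Ioc 1 a, v ^ (-θ) * thetaTail (v ^ 2)) + ∫ v in Ioi a, v ^ (-θ) * thetaTail (v ^ 2) := by
      conv_lhs => rw [hsplit]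
      rw [setIntegral_union hdisj measurableSet_Ioi (hI.mono_set (by rw [hsplit]; exact subset_union_left))
        (hI.mono_set (Ioi_subset_Ioi ha1.le))]
    -- bounds: `0 ≤ ∫_{(1,a]} ≤ 2`, `|∫_{(0,1]} k| ≤ 8`, `0 ≤ (√π/2θ)(1 - a^{-θ}) ≤ a^{1-θ}`
    obtain ⟨hpos1, hle1⟩ := integral_rpow_mul_thetaTail_Ioi_le hθ.le le_rfl
    obtain ⟨hposa, hlea⟩ := integral_rpow_mul_thetaTail_Ioi_le hθ.le ha1.le
    have hk1 := abs_integral_kfunW_le hθ1 zero_le_one le_rfl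
    rw [Real.one_rpow, mul_one, abs_le] at hk1
    have hmid : 0 ≤ ∫ v in Ioc 1 a, v ^ (-θ) * thetaTail (v ^ 2) ∧ ∫ v in Ioc 1 a, v ^ (-θ) * thetaTail (v ^ 2) ≤ 2 := by
      constructor
      · exact setIntegral_nonneg measurableSet_Ioc fun v hv ↦
          mul_nonneg (Real.rpow_nonneg (by linarith [hv.1]) _) (thetaTail_nonneg _)
      · linarith
    have hapow : 0 ≤ Real.sqrt π / (2 * θ) * (1 - a ^ (-θ)) ∧ Real.sqrt π / (2 * θ) * (1 - a ^ (-θ)) ≤ 2 * a ^ (1 - θ) := by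
      have hsπ : Real.sqrt π ≤ 2 := by
        rw [Real.sqrt_le_left (by norm_num)]; linarith [Real.pi_lt_four]
      have hapos : 0 < a ^ (-θ) := Real.rpow_pos_of_pos ha _
      have ha_le : a ^ (-θ) ≤ 1 := Real.rpow_le_one_of_one_le_of_nonpos ha1.le (by linarith)
      -- `1 - a^{-θ} ≤ θ log a` and `log a ≤ 2a^{1-θ}`
      have hlog : 1 - a ^ (-θ) ≤ θ * Real.log a := by
        have h := Real.add_one_le_exp (Real.log a * (-θ))
        rw [← Real.rpow_def_of_pos ha] at h
        linarith
      have hloga : Real.log a ≤ 2 * a ^ (1 - θ) := by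
        have h1 : Real.log a ≤ 2 * a ^ (1 / 2 : ℝ) := by
          have := Real.log_le_rpow_div ha.le (show (0:ℝ) < 1 / 2 by norm_num)
          linarith [Real.rpow_nonneg ha.le (1 / 2 : ℝ)]
        have h2 : a ^ (1 / 2 : ℝ) ≤ a ^ (1 - θ) := Real.rpow_le_rpow_of_exponent_le ha1.le (by linarith)
        linarith
      have hloga0 : 0 ≤ Real.log a := Real.log_nonneg ha1.le
      constructor
      · exact mul_nonneg (by positivity) (by linarith)
      · calc Real.sqrt π / (2 * θ) * (1 - a ^ (-θ)) ≤ 2 / (2 * θ) * (θ * Real.log a) :=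
              mul_le_mul (div_le_div_of_nonneg_right hsπ (by positivity)) hlog (by linarith) (by positivity)
          _ = Real.log a := by field_simp
          _ ≤ 2 * a ^ (1 - θ) := hloga
    have ha1θ : 1 ≤ a ^ (1 - θ) := Real.one_le_rpow ha1.le (by linarith)
    have hexpr : (∫ v in Ioi a, v ^ (-θ) * thetaTail (v ^ 2)) - Real.sqrt π / (2 * θ) * a ^ (-θ) - cW θ =
        -(∫ v in Ioc 1 a, v ^ (-θ) * thetaTail (v ^ 2)) + Real.sqrt π / (2 * θ) * (1 - a ^ (-θ)) -
          ∫ v in Ioc 0 1, kfunW θ v := by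
      rw [cW, h1a]; ring
    rw [hexpr, abs_le]
    constructor
    · nlinarith [hmid.1, hmid.2, hapow.1, hapow.2, hk1.1, hk1.2]
    · nlinarith [hmid.1, hmid.2, hapow.1, hapow.2, hk1.1, hk1.2]

/-! ## §4 The expansion of `W(η)` -/

/-- **Titchmarsh (10.11), the `r`-sum:** for `η > 0`, `x ≥ 1`, `0 < θ ≤ ½`,
`|W(η;x,θ) - √π/(2θx^θ√η) - c(θ) η^{(θ-1)/2}| ≤ 12 x^{1-θ}`, where `c(θ)` (`= K₁(θ)/θ` in the book)
is independent of `η` and `x` and satisfies `|c(θ)| ≤ 11/θ` (`abs_cW_le`).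
[cite: Titchmarsh1986, §10.11] -/
theorem abs_Wsum_sub_le {η x θ : ℝ} (hη : 0 < η) (hx : 1 ≤ x) (hθ : 0 < θ) (hθ1 : θ ≤ 1 / 2) :
    |Wsum η x θ - Real.sqrt π / (2 * θ * x ^ θ * Real.sqrt η) - cW θ * η ^ ((θ - 1) / 2)| ≤
      12 * x ^ (1 - θ) := by
  have hx0 : 0 < x := by linarith
  have hs : 0 < Real.sqrt η := Real.sqrt_pos.mpr hη
  have ha : 0 < Real.sqrt η * x := by positivity
  rw [Wsum_eq_integral_thetaTail hη hx hθ.le, integral_thetaTail_subst hη hx0.le]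
  have hF := abs_F_sub_le hθ hθ1 ha
  set F := ∫ v in Ioi (Real.sqrt η * x), v ^ (-θ) * thetaTail (v ^ 2) with hFdef
  have hηpow : 0 < η ^ ((θ - 1) / 2) := Real.rpow_pos_of_pos hη _
  -- `η^{(θ-1)/2} (√η x)^{-θ} = x^{-θ} η^{-1/2}` and `η^{(θ-1)/2} (√η x)^{1-θ} = x^{1-θ}`
  have hid1 : η ^ ((θ - 1) / 2) * (Real.sqrt π / (2 * θ) * (Real.sqrt η * x) ^ (-θ)) =
      Real.sqrt π / (2 * θ * x ^ θ * Real.sqrt η) := by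
    rw [Real.mul_rpow hs.le hx0.le, Real.sqrt_eq_rpow η, ← Real.rpow_mul hη.le, Real.rpow_neg hx0.le]
    have : η ^ ((θ - 1) / 2) * η ^ (1 / 2 * -θ) = (η ^ (1 / 2 : ℝ))⁻¹ := by
      rw [← Real.rpow_add hη, ← Real.rpow_neg hη.le]; ring_nf
    calc η ^ ((θ - 1) / 2) * (Real.sqrt π / (2 * θ) * (η ^ (1 / 2 * -θ) * (x ^ θ)⁻¹))
        = Real.sqrt π / (2 * θ) * (x ^ θ)⁻¹ * (η ^ ((θ - 1) / 2) * η ^ (1 / 2 * -θ)) := by ring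
      _ = _ := by rw [this]; field_simp
  have hid2 : η ^ ((θ - 1) / 2) * (Real.sqrt η * x) ^ (1 - θ) = x ^ (1 - θ) := by
    rw [Real.mul_rpow hs.le hx0.le, Real.sqrt_eq_rpow η, ← Real.rpow_mul hη.le]
    have : η ^ ((θ - 1) / 2) * η ^ (1 / 2 * (1 - θ)) = 1 := by
      rw [← Real.rpow_add hη]; ring_nf; exact Real.rpow_zero η
    calc η ^ ((θ - 1) / 2) * (η ^ (1 / 2 * (1 - θ)) * x ^ (1 - θ))
        = (η ^ ((θ - 1) / 2) * η ^ (1 / 2 * (1 - θ))) * x ^ (1 - θ) := by ring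
      _ = _ := by rw [this, one_mul]
  have key : η ^ ((θ - 1) / 2) * F - Real.sqrt π / (2 * θ * x ^ θ * Real.sqrt η) - cW θ * η ^ ((θ - 1) / 2) =
      η ^ ((θ - 1) / 2) * (F - Real.sqrt π / (2 * θ) * (Real.sqrt η * x) ^ (-θ) - cW θ) := by
    rw [← hid1]; ring
  rw [key, abs_mul, abs_of_pos hηpow]
  calc η ^ ((θ - 1) / 2) * |F - Real.sqrt π / (2 * θ) * (Real.sqrt η * x) ^ (-θ) - cW θ|
      ≤ η ^ ((θ - 1) / 2) * (12 * (Real.sqrt η * x) ^ (1 - θ)) := mul_le_mul_of_nonneg_left hF hηpow.le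
    _ = 12 * x ^ (1 - θ) := by rw [← hid2]; ring

/-- `W(η) ≥ 0`. [folklore] -/
theorem Wsum_nonneg {η x θ : ℝ} (hx : 0 ≤ x) : 0 ≤ Wsum η x θ :=
  tsum_nonneg fun _ ↦ setIntegral_nonneg measurableSet_Ioi fun _ hu ↦
    mul_nonneg (Real.exp_pos _).le (Real.rpow_nonneg (hx.trans (le_of_lt hu)) _)

end Literature.NumberTheory.LFunctions.SelbergMollifier
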